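import Literature.Geometry.Kaehler.MatrixFormAlgebra
import Literature.Geometry.Kaehler.PluriharmonicLog
import Literature.Geometry.Kaehler.LocalForms
import Literature.NumberTheory.Transcendental.FormsAlgebraWedgeProofs
import HarnessLib

/-!
# Local calculus of matrices of forms: pointwise Leibniz rule, `0`-forms as function factors

Layer `Literature/Geometry/Kaehler`. Second file of the Chern–Weil package for cocycle bundles
(`ComplexVectorBundle`, `MatrixFormAlgebra`). The connection forms `ω_i` of a connection on a
cocycle are smooth only ON `U_i` (`Connection.isSmoothFormOn_form`), so Kobayashi's computations
("`dΩ = Ω ∧ ω - ω ∧ Ω`", "`d tr(Ωᵏ) = 0`", Ch. II (2.4)) must be carried out POINTWISE at the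
points of `U_i`, with smoothness hypotheses at the point only. This file supplies that local
calculus, all PROVED:

* scalar forms, any real model with corners, no compatibility of the atlas: smoothness at a point
  is preserved by `∧`, casts and finite sums (`MForm.SmoothAt.wedge`, `.castDeg`,
  `MForm.smoothAt_sum`); `d` commutes with finite sums at a point of smoothness
  (`mextDeriv_sum_apply_of_smoothAt`, from the tree's `mextDeriv_add_apply` of `LocalForms`); the
  **pointwise
  Leibniz rule** `d(α ∧ β)(x) = (dα ∧ β)(x) + (-1)^k (α ∧ dβ)(x)` for forms smooth at `x`
  (`mextDeriv_wedge_apply_of_smoothAt` — the proof of the tree's global `MextDerivWedge_holds`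
  is already pointwise; Warner (1983), 2.20);
* `0`-forms as factors: `f ∧ β = f • β` and `α ∧ f = f • α` (`MForm.ofFun_wedge`,
  `MForm.wedge_ofFun`, from `constOfIsEmpty_one_wedge` and graded commutativity), whence for
  matrices `ofFun g ∧ A = g · A`, `A ∧ ofFun g = A · g`, `ofFun (g h) = g · ofFun h = (ofFun g) · h`
  and the entrywise expansions of `g · A`, `A · g` as sums of wedges with `0`-forms;
* matrices: smoothness at a point of `A ∧ B`, `g · A`, `A · g` (`MatrixForm.smoothAt_*`) and the
  pointwise Leibniz rules `d(A ∧ B) = dA ∧ B + (-1)^k A ∧ dB`,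
  `d(g · A) = dg ∧ A + g · dA`, `d(A · g) = dA · g + (-1)^k A ∧ dg`
  (`MatrixForm.d_wedge_apply`, `.d_mulLeft_apply`, `.d_mulRight_apply`; Kobayashi, Ch. I §1,
  the computations behind (1.13)–(1.17)).

## References

* S. Kobayashi, *Differential Geometry of Complex Vector Bundles* (1987), Ch. I §1 (1.12)–(1.17),
  Ch. II §2 (2.4).
* F. W. Warner, *Foundations of Differentiable Manifolds and Lie Groups* (GTM 94), 2.15–2.20.
-/

noncomputable section

open scoped Manifold ContDiff Topology Matrix
open Set Filter
open Literature.NumberTheory.Transcendental (inChart_wedge extDerivWithin_wedge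
  mextDeriv_eq_extDerivWithin_of_chartedSpace inChart_apply_self_of_chartedSpace mextDeriv_castDeg)

/-! ### `0`-forms as factors of a wedge (pointwise) -/

namespace ContinuousAlternatingMap

section ZeroFactors

variable {𝕜 : Type*} [RCLike 𝕜] {V : Type*} [NormedAddCommGroup V] [NormedSpace 𝕜 V]
  {A : Type*} [NormedCommRing A] [NormedAlgebra 𝕜 A] {k l : ℕ}

/-- A `0`-form `c` as a left factor of a wedge acts as the scalar `c` (Warner (1983), 2.6;
from the unit case `constOfIsEmpty_one_wedge`). Deliberate extension of the Mathlib namespace,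
as the tree's `wedge`. [cite: WarnerGTM94, 2.6] -/
theorem constOfIsEmpty_wedge (c : A) (β : V [⋀^Fin l]→L[𝕜] A) :
    (constOfIsEmpty 𝕜 V (Fin 0) c).wedge β = c • β.domDomCongr (finCongr (Nat.zero_add l).symm) := by
  have h : constOfIsEmpty 𝕜 V (Fin 0) c = c • constOfIsEmpty 𝕜 V (Fin 0) (1 : A) := by
    ext v
    simp
  rw [h, algebra_smul_wedge, constOfIsEmpty_one_wedge]

/-- A `0`-form `c` as a right factor of a wedge acts as the scalar `c` (graded commutativity,
`WedgeComm_holds`, and `constOfIsEmpty_wedge`). [cite: WarnerGTM94, 2.6] -/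
theorem wedge_constOfIsEmpty (α : V [⋀^Fin k]→L[𝕜] A) (c : A) :
    α.wedge (constOfIsEmpty 𝕜 V (Fin 0) c) = c • α := by
  rw [ContinuousAlternatingMap.WedgeComm_holds 𝕜 V A (constOfIsEmpty 𝕜 V (Fin 0) c) α,
    constOfIsEmpty_wedge, zero_mul, pow_zero, one_smul]
  ext v
  simp only [domDomCongr_apply, smul_apply]
  exact congrArg (fun w ↦ c • α w) (funext fun i ↦ congrArg v (Fin.ext rfl))

end ZeroFactors

end ContinuousAlternatingMap

namespace Literature.Geometry.Kaehler

/-! ### Scalar forms: smoothness at a point, pointwise additivity and Leibniz rule for `d` -/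

section Scalar

variable {E : Type*} [NormedAddCommGroup E] [NormedSpace ℝ E]
  {H : Type*} [TopologicalSpace H] {I : ModelWithCorners ℝ E H}
  {M : Type*} [TopologicalSpace M] [ChartedSpace H M]
  {F : Type*} [NormedAddCommGroup F] [NormedSpace ℝ F]
  {A : Type*} [NormedCommRing A] [NormedAlgebra ℝ A] {k l k' : ℕ}

/-- A degree cast along any proof of `k = k` is the identity. [folklore] -/
theorem MForm.castDeg_eq_self (h : k = k) (α : MForm I M F k) : α.castDeg h = α :=
  MForm.castDeg_rfl α

/-- Degree casts of forms agreeing at `x` agree at `x`. [folklore] -/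
theorem MForm.castDeg_apply_eq (h : k = k') {γ δ : MForm I M F k} {x : M} (hx : γ x = δ x) :
    γ.castDeg h x = δ.castDeg h x := by
  subst h; exact hx

/-- Smoothness at a point is preserved by degree casts. [folklore] -/
theorem MForm.SmoothAt.castDeg (h : k = k') {α : MForm I M F k} {x : M} (hα : α.SmoothAt x) :
    (α.castDeg h).SmoothAt x := by
  subst h; exact hα

/-- Smoothness at a point is preserved by finite sums. [folklore] -/
theorem MForm.smoothAt_sum {ι : Type*} (s : Finset ι) {α : ι → MForm I M F k} {x : M}
    (h : ∀ i ∈ s, (α i).SmoothAt x) : (∑ i ∈ s, α i).SmoothAt x := by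
  classical
  induction s using Finset.induction_on with
  | empty => rw [Finset.sum_empty]; exact MForm.smoothAt_zero x
  | insert i s hi ih =>
    rw [Finset.sum_insert hi]
    exact (h i (Finset.mem_insert_self i s)).add (ih fun j hj ↦ h j (Finset.mem_insert_of_mem hj))

/-- **The wedge of forms smooth at `x` is smooth at `x`** (Warner (1983), 2.17, pointwise: in the
chart at `x` the representative of `α ∧ β` is the wedge of the representatives, a continuous
bilinear image). [cite: WarnerGTM94, 2.17] -/
theorem MForm.SmoothAt.wedge {α : MForm I M A k} {β : MForm I M A l} {x : M} (hα : α.SmoothAt x)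
    (hβ : β.SmoothAt x) : (α.wedge β).SmoothAt x := by
  rw [MForm.SmoothAt, inChart_wedge]
  exact ContDiffWithinAt.wedge hα hβ

/-- `d` commutes with finite sums at a point where all summands are smooth. [cite: WarnerGTM94, 2.20] -/
theorem mextDeriv_sum_apply_of_smoothAt {ι : Type*} (s : Finset ι) {α : ι → MForm I M F k}
    {x : M} (h : ∀ i ∈ s, (α i).SmoothAt x) :
    mextDeriv (∑ i ∈ s, α i) x = ∑ i ∈ s, mextDeriv (α i) x := by
  classical
  induction s using Finset.induction_on with
  | empty => rw [Finset.sum_empty, Finset.sum_empty, mextDeriv_zero]; rfl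
  | insert i s hi ih =>
    rw [Finset.sum_insert hi, Finset.sum_insert hi,
      mextDeriv_add_apply (h i (Finset.mem_insert_self i s))
        (MForm.smoothAt_sum s fun j hj ↦ h j (Finset.mem_insert_of_mem hj)),
      ih fun j hj ↦ h j (Finset.mem_insert_of_mem hj)]

/-- **Pointwise Leibniz rule**: `d(α ∧ β)(x) = (dα ∧ β)(x) + (-1)^k (α ∧ dβ)(x)` for forms smooth
at `x` (Warner (1983), Thm. 2.20(2); the chart computation of the tree's `MextDerivWedge_holds`,
which uses smoothness at the point only). [cite: WarnerGTM94, Thm. 2.20] -/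
theorem mextDeriv_wedge_apply_of_smoothAt {α : MForm I M A k} {β : MForm I M A l} {x : M}
    (hα : α.SmoothAt x) (hβ : β.SmoothAt x) :
    mextDeriv (α.wedge β) x =
      ((mextDeriv α).wedge β).castDeg (Nat.add_right_comm k 1 l) x +
        (((-1 : ℝ) ^ k) • α.wedge (mextDeriv β)) x := by
  have hU : UniqueDiffWithinAt ℝ (range I) (extChartAt I x x) :=
    I.uniqueDiffOn _ (extChartAt_target_subset_range x (mem_extChartAt_target x))
  rw [mextDeriv_eq_extDerivWithin_of_chartedSpace, inChart_wedge,
    extDerivWithin_wedge (ContDiffWithinAt.differentiableWithinAt hα (by simp))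
      (ContDiffWithinAt.differentiableWithinAt hβ (by simp)) hU,
    inChart_apply_self_of_chartedSpace, inChart_apply_self_of_chartedSpace,
    ← mextDeriv_eq_extDerivWithin_of_chartedSpace, ← mextDeriv_eq_extDerivWithin_of_chartedSpace]
  rfl

/-! ### `0`-forms as factors -/

/-- `f ∧ β = f • β` for a function `f` (as the `0`-form `MForm.ofFun I f`), up to the cast along
`0 + l = l`. [cite: WarnerGTM94, 2.6] -/
theorem MForm.ofFun_wedge (c : M → A) (β : MForm I M A l) :
    (MForm.ofFun I c).wedge β = MForm.castDeg (Nat.zero_add l).symm (fun x ↦ c x • β x) := by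
  funext x
  have h := ContinuousAlternatingMap.constOfIsEmpty_wedge (𝕜 := ℝ) (V := E) (c x)
    (show E [⋀^Fin l]→L[ℝ] A from β x)
  refine h.trans ?_
  ext v
  rfl

/-- `α ∧ f = f • α` for a function `f` (the degree `k + 0` is `k`). [cite: WarnerGTM94, 2.6] -/
theorem MForm.wedge_ofFun (α : MForm I M A k) (c : M → A) :
    α.wedge (MForm.ofFun I c) = fun x ↦ c x • α x :=
  funext fun x ↦ ContinuousAlternatingMap.wedge_constOfIsEmpty (V := E) (α x) (c x)

/-- A function `C^∞` at `x` gives a `0`-form smooth at `x` scaled wedge: `f • β` is smooth at `x`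
if `f` and `β` are. [cite: WarnerGTM94, 2.17] -/
theorem MForm.smoothAt_funSmul {c : M → A} {β : MForm I M A l} {x : M}
    (hc : ContMDiffAt I 𝓘(ℝ, A) ∞ c x) (hβ : β.SmoothAt x) :
    MForm.SmoothAt (fun y ↦ c y • β y : MForm I M A l) x := by
  have h : (fun y ↦ c y • β y : MForm I M A l) =
      ((MForm.ofFun I c).wedge β).castDeg (Nat.zero_add l) := by
    rw [MForm.ofFun_wedge, MForm.castDeg_castDeg]
    exact (MForm.castDeg_eq_self _ _).symm
  rw [h]
  exact ((MForm.smoothAt_ofFun_of_contMDiffAt hc).wedge hβ).castDeg _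

end Scalar

/-! ### Matrices of forms: `0`-form factors, smoothness at a point, pointwise Leibniz rules -/

namespace MatrixForm

variable {E : Type*} [NormedAddCommGroup E] [NormedSpace ℝ E]
  {H : Type*} [TopologicalSpace H] {I : ModelWithCorners ℝ E H}
  {M : Type*} [TopologicalSpace M] [ChartedSpace H M] {r k l : ℕ}

/-- `ofFun g ∧ A = g · A` up to the cast along `0 + k = k`. [cite: Kobayashi1987, Ch. I §1 (1.16)] -/
theorem ofFun_wedge (g : M → Matrix (Fin r) (Fin r) ℂ) (A : MatrixForm I M r k) :
    (ofFun (I := I) g).wedge A = (mulLeft g A).castDeg (Nat.zero_add k).symm := by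
  refine Matrix.ext fun a b ↦ ?_
  simp only [wedge_apply, ofFun_apply, MForm.ofFun_wedge, castDeg_apply, ← MForm.castDeg_sum]
  congr 1
  funext x
  simp only [Finset.sum_apply, mulLeft_apply]

/-- `A ∧ ofFun g = A · g` (the degree `k + 0` is `k`). [cite: Kobayashi1987, Ch. I §1 (1.16)] -/
theorem wedge_ofFun (A : MatrixForm I M r k) (g : M → Matrix (Fin r) (Fin r) ℂ) :
    A.wedge (ofFun (I := I) g) = A.mulRight g := by
  ext a b x : 2
  simp only [wedge_apply, ofFun_apply, MForm.wedge_ofFun, Finset.sum_apply, mulRight_apply]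

/-- The entries of `g · A` as sums of wedges with `0`-forms:
`(g · A)_{ab} = Σ_c g_{ac} ∧ A_{cb}` (cast along `0 + k = k`). [cite: Kobayashi1987, Ch. I §1] -/
theorem mulLeft_apply_eq_sum (g : M → Matrix (Fin r) (Fin r) ℂ) (A : MatrixForm I M r k)
    (a b : Fin r) :
    mulLeft g A a b = ∑ c, ((MForm.ofFun I fun y ↦ g y a c).wedge (A c b)).castDeg (Nat.zero_add k) := by
  funext x
  simp only [mulLeft_apply, Finset.sum_apply, MForm.ofFun_wedge, MForm.castDeg_castDeg,
    MForm.castDeg_eq_self]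

/-- The entries of `A · g` as sums of wedges with `0`-forms: `(A · g)_{ab} = Σ_c A_{ac} ∧ g_{cb}`.
[cite: Kobayashi1987, Ch. I §1] -/
theorem mulRight_apply_eq_sum (A : MatrixForm I M r k) (g : M → Matrix (Fin r) (Fin r) ℂ)
    (a b : Fin r) : A.mulRight g a b = ∑ c, (A a c).wedge (MForm.ofFun I fun y ↦ g y c b) := by
  funext x
  simp only [mulRight_apply, Finset.sum_apply, MForm.wedge_ofFun]

/-- `ofFun (g h) = g · ofFun h` (a product of functions as a `0`-form). [folklore] -/
theorem ofFun_mul (g h : M → Matrix (Fin r) (Fin r) ℂ) :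
    ofFun (I := I) (g * h) = mulLeft g (ofFun h) := by
  ext a b x v : 3
  simp only [ofFun_apply, MForm.ofFun_apply, Pi.mul_apply, Matrix.mul_apply, mulLeft_apply,
    ContinuousAlternatingMap.sum_apply, ContinuousAlternatingMap.smul_apply, smul_eq_mul]

/-- `ofFun (g h) = (ofFun g) · h`. [folklore] -/
theorem ofFun_mul' (g h : M → Matrix (Fin r) (Fin r) ℂ) :
    ofFun (I := I) (g * h) = (ofFun g).mulRight h := by
  ext a b x v : 3
  simp only [ofFun_apply, MForm.ofFun_apply, Pi.mul_apply, Matrix.mul_apply, mulRight_apply,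
    ContinuousAlternatingMap.sum_apply, ContinuousAlternatingMap.smul_apply, smul_eq_mul]
  exact Finset.sum_congr rfl fun c _ ↦ mul_comm _ _

/-- A degree cast of a matrix of forms along any proof of `k = k` is the identity. [folklore] -/
theorem castDeg_eq_self (h : k = k) (A : MatrixForm I M r k) : A.castDeg h = A :=
  castDeg_rfl A

/-- The value of `A ∧ B` at `x` only depends on the values of the entries at `x`. [folklore] -/
theorem wedge_apply_congr {A A' : MatrixForm I M r k} {B B' : MatrixForm I M r l} {x : M}
    {a b : Fin r} (hA : ∀ c, A a c x = A' a c x) (hB : ∀ c, B c b x = B' c b x) :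
    (A.wedge B) a b x = (A'.wedge B') a b x := by
  simp only [wedge_apply, Finset.sum_apply, MForm.wedge_apply, hA, hB]

/-- The value of `g · A` at `x` only depends on the values of the entries of `A` at `x`. [folklore] -/
theorem mulLeft_apply_congr_right (g : M → Matrix (Fin r) (Fin r) ℂ) {A A' : MatrixForm I M r k}
    {x : M} {a b : Fin r} (hA : ∀ c, A c b x = A' c b x) : mulLeft g A a b x = mulLeft g A' a b x := by
  simp only [mulLeft_apply, hA]

/-- The value of `A · g` at `x` only depends on the values of the entries of `A` at `x`. [folklore] -/
theorem mulRight_apply_congr_left {A A' : MatrixForm I M r k} (g : M → Matrix (Fin r) (Fin r) ℂ)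
    {x : M} {a b : Fin r} (hA : ∀ c, A a c x = A' a c x) : mulRight A g a b x = mulRight A' g a b x := by
  simp only [mulRight_apply, hA]

/-! #### Smoothness at a point -/

/-- The entries of `A ∧ B` are smooth at `x` if those of `A` and `B` are. [cite: WarnerGTM94, 2.17] -/
theorem smoothAt_wedge {A : MatrixForm I M r k} {B : MatrixForm I M r l} {x : M}
    (hA : ∀ a b, (A a b).SmoothAt x) (hB : ∀ a b, (B a b).SmoothAt x) (a b : Fin r) :
    ((A.wedge B) a b).SmoothAt x := by
  rw [wedge_apply]
  exact MForm.smoothAt_sum _ fun c _ ↦ (hA a c).wedge (hB c b)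

/-- The entries of `g · A` are smooth at `x` if `g` is `C^∞` at `x` and the entries of `A` are
smooth at `x`. [cite: WarnerGTM94, 2.17] -/
theorem smoothAt_mulLeft {g : M → Matrix (Fin r) (Fin r) ℂ} {A : MatrixForm I M r k} {x : M}
    (hg : ∀ a b, ContMDiffAt I 𝓘(ℝ, ℂ) ∞ (fun y ↦ g y a b) x) (hA : ∀ a b, (A a b).SmoothAt x)
    (a b : Fin r) : (mulLeft g A a b).SmoothAt x := by
  rw [mulLeft_apply_eq_sum]
  exact MForm.smoothAt_sum _ fun c _ ↦
    ((MForm.smoothAt_ofFun_of_contMDiffAt (hg a c)).wedge (hA c b)).castDeg _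

/-- The entries of `A · g` are smooth at `x` if `g` is `C^∞` at `x` and the entries of `A` are
smooth at `x`. [cite: WarnerGTM94, 2.17] -/
theorem smoothAt_mulRight {A : MatrixForm I M r k} {g : M → Matrix (Fin r) (Fin r) ℂ} {x : M}
    (hA : ∀ a b, (A a b).SmoothAt x) (hg : ∀ a b, ContMDiffAt I 𝓘(ℝ, ℂ) ∞ (fun y ↦ g y a b) x)
    (a b : Fin r) : (A.mulRight g a b).SmoothAt x := by
  rw [mulRight_apply_eq_sum]
  exact MForm.smoothAt_sum _ fun c _ ↦ (hA a c).wedge (MForm.smoothAt_ofFun_of_contMDiffAt (hg c b))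

/-- The entries of `ofFun g` are smooth at `x` if `g` is `C^∞` at `x`. [cite: WarnerGTM94, 2.15] -/
theorem smoothAt_ofFun {g : M → Matrix (Fin r) (Fin r) ℂ} {x : M}
    (hg : ∀ a b, ContMDiffAt I 𝓘(ℝ, ℂ) ∞ (fun y ↦ g y a b) x) (a b : Fin r) :
    (ofFun (I := I) g a b).SmoothAt x :=
  MForm.smoothAt_ofFun_of_contMDiffAt (hg a b)

/-- The entries of a degree cast are smooth at `x` if those of the matrix are. [folklore] -/
theorem smoothAt_castDeg {k' : ℕ} (h : k = k') {A : MatrixForm I M r k} {x : M}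
    (hA : ∀ a b, (A a b).SmoothAt x) (a b : Fin r) : (A.castDeg h a b).SmoothAt x :=
  (hA a b).castDeg h

/-! #### Pointwise Leibniz rules -/

/-- `d` is additive on matrices of forms at a point where all entries are smooth. [cite: WarnerGTM94, 2.20] -/
theorem d_add_apply {A B : MatrixForm I M r k} {x : M} (hA : ∀ a b, (A a b).SmoothAt x)
    (hB : ∀ a b, (B a b).SmoothAt x) (a b : Fin r) : (A + B).d a b x = A.d a b x + B.d a b x := by
  simp only [d_apply, Matrix.add_apply]
  exact mextDeriv_add_apply (hA a b) (hB a b)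


/-- **Leibniz rule for the matrix wedge, pointwise**: `d(A ∧ B)(x) = (dA ∧ B)(x) + (-1)^k (A ∧ dB)(x)`
for matrices of forms whose entries are smooth at `x` (entrywise `mextDeriv_wedge_apply_of_smoothAt`;
Kobayashi, Ch. I §1, e.g. the derivation of (1.13)–(1.14)). [cite: Kobayashi1987, Ch. I §1 (1.13)–(1.14)] -/
theorem d_wedge_apply {A : MatrixForm I M r k} {B : MatrixForm I M r l} {x : M}
    (hA : ∀ a b, (A a b).SmoothAt x) (hB : ∀ a b, (B a b).SmoothAt x) (a b : Fin r) :
    (A.wedge B).d a b x =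
      ((A.d.wedge B).castDeg (Nat.add_right_comm k 1 l)) a b x + (((-1 : ℝ) ^ k) • A.wedge B.d) a b x := by
  simp only [d_apply, wedge_apply, castDeg_apply, Matrix.smul_apply]
  rw [mextDeriv_sum_apply_of_smoothAt _ fun c _ ↦ (hA a c).wedge (hB c b),
    Finset.sum_congr rfl fun c _ ↦ mextDeriv_wedge_apply_of_smoothAt (hA a c) (hB c b)]
  simp only [Finset.sum_add_distrib, Finset.sum_apply, Pi.smul_apply, Finset.smul_sum,
    MForm.castDeg_sum]

/-- **`d(g · A)(x) = (dg ∧ A)(x) + (g · dA)(x)`** for `g` `C^∞` at `x` and `A` with entries smooth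
at `x` (the first summand cast along `0 + 1 + k = k + 1`). [cite: Kobayashi1987, Ch. I §1 (1.16)–(1.17)] -/
theorem d_mulLeft_apply {g : M → Matrix (Fin r) (Fin r) ℂ} {A : MatrixForm I M r k} {x : M}
    (hg : ∀ a b, ContMDiffAt I 𝓘(ℝ, ℂ) ∞ (fun y ↦ g y a b) x) (hA : ∀ a b, (A a b).SmoothAt x)
    (h : 0 + 1 + k = k + 1) (a b : Fin r) :
    (mulLeft g A).d a b x =
      (((ofFun (I := I) g).d.wedge A).castDeg h) a b x + (mulLeft g A.d) a b x := by
  have hφ : ∀ c, (MForm.ofFun I fun y ↦ g y a c).SmoothAt x := fun c ↦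
    MForm.smoothAt_ofFun_of_contMDiffAt (hg a c)
  have key : ∀ c,
      mextDeriv (((MForm.ofFun I fun y ↦ g y a c).wedge (A c b)).castDeg (Nat.zero_add k)) x =
        ((mextDeriv (MForm.ofFun I fun y ↦ g y a c)).wedge (A c b)).castDeg h x +
          g x a c • mextDeriv (A c b) x := by
    intro c
    have hL : mextDeriv ((MForm.ofFun I fun y ↦ g y a c).wedge (A c b)) x =
        (((mextDeriv (MForm.ofFun I fun y ↦ g y a c)).wedge (A c b)).castDeg
            (Nat.add_right_comm 0 1 k) +
          ((-1 : ℝ) ^ 0) • (MForm.ofFun I fun y ↦ g y a c).wedge (mextDeriv (A c b))) x :=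
      mextDeriv_wedge_apply_of_smoothAt (hφ c) (hA c b)
    rw [mextDeriv_castDeg, MForm.castDeg_apply_eq _ hL, MForm.castDeg_add, Pi.add_apply,
      MForm.castDeg_castDeg, pow_zero, one_smul, MForm.ofFun_wedge, MForm.castDeg_castDeg,
      MForm.castDeg_eq_self]
  rw [d_apply, mulLeft_apply_eq_sum, mextDeriv_sum_apply_of_smoothAt _ fun c _ ↦
    ((hφ c).wedge (hA c b)).castDeg _, Finset.sum_congr rfl fun c _ ↦ key c]
  simp only [Finset.sum_add_distrib, castDeg_apply, wedge_apply, d_apply, ofFun_apply,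
    MForm.castDeg_sum, Finset.sum_apply, mulLeft_apply]

/-- **`d(A · g)(x) = (dA · g)(x) + (-1)^k (A ∧ dg)(x)`** for `A` with entries smooth at `x` and `g`
`C^∞` at `x` (the degree `k + (0 + 1)` is `k + 1`). [cite: Kobayashi1987, Ch. I §1 (1.16)–(1.17)] -/
theorem d_mulRight_apply {A : MatrixForm I M r k} {g : M → Matrix (Fin r) (Fin r) ℂ} {x : M}
    (hA : ∀ a b, (A a b).SmoothAt x) (hg : ∀ a b, ContMDiffAt I 𝓘(ℝ, ℂ) ∞ (fun y ↦ g y a b) x)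
    (a b : Fin r) :
    (A.mulRight g).d a b x =
      ((A.d).mulRight g) a b x + (((-1 : ℝ) ^ k) • A.wedge (ofFun (I := I) g).d) a b x := by
  have hφ : ∀ c, (MForm.ofFun I fun y ↦ g y c b).SmoothAt x := fun c ↦
    MForm.smoothAt_ofFun_of_contMDiffAt (hg c b)
  have key : ∀ c, mextDeriv ((A a c).wedge (MForm.ofFun I fun y ↦ g y c b)) x =
      g x c b • mextDeriv (A a c) x +
        (((-1 : ℝ) ^ k) • (A a c).wedge (mextDeriv (MForm.ofFun I fun y ↦ g y c b))) x := by
    intro c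
    rw [mextDeriv_wedge_apply_of_smoothAt (hA a c) (hφ c), MForm.castDeg_eq_self,
      MForm.wedge_ofFun]
  rw [d_apply, mulRight_apply_eq_sum, mextDeriv_sum_apply_of_smoothAt _ fun c _ ↦
    (hA a c).wedge (hφ c), Finset.sum_congr rfl fun c _ ↦ key c]
  simp only [Finset.sum_add_distrib, wedge_apply, d_apply, ofFun_apply, Finset.sum_apply,
    mulRight_apply, Matrix.smul_apply, Pi.smul_apply, Finset.smul_sum]

end MatrixForm

end Literature.Geometry.Kaehler

end
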